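import Mathlib
import Summits.Ventures.PercRepro2.Defs
import Summits.Ventures.PercRepro2.Harris
import Summits.Ventures.PercRepro2.CoinDefs
import Summits.Ventures.PercRepro2.CoinReverse
import Summits.Ventures.PercRepro2.CoinLsmCoreDefs
import Summits.Ventures.PercRepro2.CoinLsmCoreU
import Summits.Ventures.PercRepro2.CoinSquareCoreDefs
import Summits.Ventures.PercRepro2.CoinD21Alg
import Summits.Ventures.PercRepro2.CoinOrTailAlg
import Summits.Ventures.PercRepro2.CoinOrTailDefs
import Summits.Ventures.PercRepro2.CoinOrTail3Cells
import Summits.Ventures.PercRepro2.CoinOrTailLsmDefs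
import Summits.Ventures.PercRepro2.CoinOrTailLsmSums
import Summits.Ventures.PercRepro2.CoinChordCore
import Summits.Ventures.PercRepro2.CoinTriCoreDefs

/-!
# The UNDIRECTED TRIANGLE with a tail, II: the cluster law and row 2′DARC (blind cell
PercRepro2, night-2 g9; proofs/NIGHT2-DARC.md §37.14)

The core `U = {p, q}` of `TriCore` has the cluster law `ν(∅) = (1−α)(1−β)`,
`ν({p}) = α(1−β)(1−γ)`, `ν({q}) = (1−α)β(1−γ)`, `ν({p, q}) = αβ + α(1−β)γ + (1−α)βγ`
(`TriCore.prob_level`, `nu_*`), which is log-supermodular (`TriCore.level_lsm`: the one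
non-trivial pair has the slack `α(1−α)β(1−β)γ(2−γ) + (1−α)(1−β)γ(α(1−β) + (1−α)β)`), so
`darc_of_orTailLsm` applies: **row 2′DARC holds at `a → w` for the markers `p, q` and every
head** (`darc_of_triCore`).
-/

namespace Summit.Ventures.PercRepro2.Coin

open Classical

section TriLevels

variable {V : Type*} {E : Type*} [DecidableEq V] [Fintype E] [DecidableEq E]
  {R : Type*} [Field R]
  {arcs : E → Finset (V × V)} {s p q a : V} {c₁ c₂ c₃ cρ cτ : E}

omit [Fintype E] [DecidableEq E] in
/-- On the cylinder of `b` (the coins `c₁, c₂, c₃, cρ`), membership in the level of `U = {p, q}`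
is the Boolean condition `(p ∈ W ↔ b₁ ∨ b₂ b₃) ∧ (q ∈ W ↔ b₂ ∨ b₁ b₃)`. -/
lemma TriCore.level_inter_cyl (h : TriCore arcs s p q a c₁ c₂ c₃ cρ cτ) (W : Finset V)
    (b : Bool × Bool × Bool × Bool) :
    coreLevel arcs s {p, q} W ∩ {ω | ω c₁ = b.1 ∧ ω c₂ = b.2.1 ∧ ω c₃ = b.2.2.1 ∧ ω cρ = b.2.2.2}
      = if (p ∈ W ↔ (b.1 = true ∨ (b.2.1 = true ∧ b.2.2.1 = true))) ∧
          (q ∈ W ↔ (b.2.1 = true ∨ (b.1 = true ∧ b.2.2.1 = true)))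
        then {ω | ω c₁ = b.1 ∧ ω c₂ = b.2.1 ∧ ω c₃ = b.2.2.1 ∧ ω cρ = b.2.2.2} else ∅ := by
  obtain ⟨b₁, b₂, b₃, b₄⟩ := b
  ext ω
  have hmem : ω ∈ coreLevel arcs s {p, q} W ↔
      (p ∈ W ↔ (ω c₁ = true ∨ (ω c₂ = true ∧ ω c₃ = true))) ∧
        (q ∈ W ↔ (ω c₂ = true ∨ (ω c₁ = true ∧ ω c₃ = true))) := by
    rw [mem_coreLevel]
    simp only [Finset.mem_insert, Finset.mem_singleton, forall_eq_or_imp, forall_eq,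
      h.reach_p_iff, h.reach_q_iff]
  simp only [Set.mem_inter_iff, hmem, Set.mem_setOf_eq]
  split_ifs with hc
  · simp only [Set.mem_setOf_eq]
    constructor
    · rintro ⟨_, hω⟩; exact hω
    · rintro ⟨h1, h2, h3, h4⟩
      refine ⟨?_, h1, h2, h3, h4⟩
      rw [h1, h2, h3]; exact hc
  · simp only [Set.mem_empty_iff_false, iff_false]
    rintro ⟨hW, h1, h2, h3, _⟩
    rw [h1, h2, h3] at hW
    exact hc hW

/-- The level probabilities of `U = {p, q}` as a sum over the `16` configurations of the coins
`c₁, c₂, c₃, cρ` (the tail coin is summed out). -/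
theorem TriCore.prob_level (h : TriCore arcs s p q a c₁ c₂ c₃ cρ cτ) (pr : E → R)
    (h12 : c₁ ≠ c₂) (h13 : c₁ ≠ c₃) (h1ρ : c₁ ≠ cρ) (h23 : c₂ ≠ c₃) (h2ρ : c₂ ≠ cρ) (h3ρ : c₃ ≠ cρ)
    (W : Finset V) :
    prob pr (coreLevel arcs s {p, q} W) = ∑ b : Bool × Bool × Bool × Bool,
      if (p ∈ W ↔ (b.1 = true ∨ (b.2.1 = true ∧ b.2.2.1 = true))) ∧
          (q ∈ W ↔ (b.2.1 = true ∨ (b.1 = true ∧ b.2.2.1 = true)))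
        then edgeFactor (pr c₁) b.1 * edgeFactor (pr c₂) b.2.1 * edgeFactor (pr c₃) b.2.2.1 *
          edgeFactor (pr cρ) b.2.2.2 else 0 := by
  rw [prob_eq_sum_cyl4 (c₁ := c₁) (c₂ := c₂) (c₃ := c₃) (c₄ := cρ)]
  refine Finset.sum_congr rfl fun b _ => ?_
  rw [h.level_inter_cyl W b]
  split_ifs
  · exact prob_cyl4 pr h12 h13 h1ρ h23 h2ρ h3ρ b
  · simp [prob]

/-- `ν(∅) = (1 − α)(1 − β)`. -/
theorem TriCore.nu_empty (h : TriCore arcs s p q a c₁ c₂ c₃ cρ cτ) (pr : E → R)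
    (h12 : c₁ ≠ c₂) (h13 : c₁ ≠ c₃) (h1ρ : c₁ ≠ cρ) (h23 : c₂ ≠ c₃) (h2ρ : c₂ ≠ cρ) (h3ρ : c₃ ≠ cρ) :
    prob pr (coreLevel arcs s {p, q} ∅) = (1 - pr c₁) * (1 - pr c₂) := by
  rw [h.prob_level pr h12 h13 h1ρ h23 h2ρ h3ρ]
  simp [Fintype.sum_prod_type]
  ring

/-- `ν({p}) = α(1 − β)(1 − γ)`. -/
theorem TriCore.nu_p (h : TriCore arcs s p q a c₁ c₂ c₃ cρ cτ) (pr : E → R)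
    (h12 : c₁ ≠ c₂) (h13 : c₁ ≠ c₃) (h1ρ : c₁ ≠ cρ) (h23 : c₂ ≠ c₃) (h2ρ : c₂ ≠ cρ) (h3ρ : c₃ ≠ cρ) :
    prob pr (coreLevel arcs s {p, q} {p}) = pr c₁ * (1 - pr c₂) * (1 - pr c₃) := by
  rw [h.prob_level pr h12 h13 h1ρ h23 h2ρ h3ρ]
  simp [Fintype.sum_prod_type, h.pq.symm]
  ring

/-- `ν({q}) = (1 − α)β(1 − γ)`. -/
theorem TriCore.nu_q (h : TriCore arcs s p q a c₁ c₂ c₃ cρ cτ) (pr : E → R)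
    (h12 : c₁ ≠ c₂) (h13 : c₁ ≠ c₃) (h1ρ : c₁ ≠ cρ) (h23 : c₂ ≠ c₃) (h2ρ : c₂ ≠ cρ) (h3ρ : c₃ ≠ cρ) :
    prob pr (coreLevel arcs s {p, q} {q}) = (1 - pr c₁) * pr c₂ * (1 - pr c₃) := by
  rw [h.prob_level pr h12 h13 h1ρ h23 h2ρ h3ρ]
  simp [Fintype.sum_prod_type, h.pq]
  ring

/-- `ν({p, q}) = αβ + α(1 − β)γ + (1 − α)βγ`. -/
theorem TriCore.nu_pq (h : TriCore arcs s p q a c₁ c₂ c₃ cρ cτ) (pr : E → R)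
    (h12 : c₁ ≠ c₂) (h13 : c₁ ≠ c₃) (h1ρ : c₁ ≠ cρ) (h23 : c₂ ≠ c₃) (h2ρ : c₂ ≠ cρ) (h3ρ : c₃ ≠ cρ) :
    prob pr (coreLevel arcs s {p, q} {p, q}) =
      pr c₁ * pr c₂ + pr c₁ * (1 - pr c₂) * pr c₃ + (1 - pr c₁) * pr c₂ * pr c₃ := by
  rw [h.prob_level pr h12 h13 h1ρ h23 h2ρ h3ρ]
  simp [Fintype.sum_prod_type]
  ring

/-- **The cluster law of the undirected triangle's `U = {p, q}` is log-supermodular**: the one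
non-trivial pair is `ν(p)ν(q) ≤ ν(∅)ν(pq)`, with the slack
`α(1−α)β(1−β)γ(2−γ) + (1−α)(1−β)γ(α(1−β) + (1−α)β)`. -/
theorem TriCore.level_lsm (h : TriCore arcs s p q a c₁ c₂ c₃ cρ cτ) (pr : E → R)
    [LinearOrder R] [IsStrictOrderedRing R] (hp : IsProbVec pr)
    (h12 : c₁ ≠ c₂) (h13 : c₁ ≠ c₃) (h1ρ : c₁ ≠ cρ) (h23 : c₂ ≠ c₃) (h2ρ : c₂ ≠ cρ) (h3ρ : c₃ ≠ cρ) :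
    ∀ W W', W ⊆ ({p, q} : Finset V) → W' ⊆ {p, q} →
      prob pr (coreLevel arcs s {p, q} W) * prob pr (coreLevel arcs s {p, q} W') ≤
        prob pr (coreLevel arcs s {p, q} (W ∩ W')) * prob pr (coreLevel arcs s {p, q} (W ∪ W')) := by
  intro W W' hW hW'
  have hpq := h.pq
  have e1 : ({p} : Finset V) ∩ {q} = ∅ := Finset.disjoint_iff_inter_eq_empty.1
    (Finset.disjoint_singleton.2 hpq)
  have e2 : ({q} : Finset V) ∩ {p} = ∅ := Finset.disjoint_iff_inter_eq_empty.1
    (Finset.disjoint_singleton.2 hpq.symm)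
  have e3 : ({p} : Finset V) ∪ {q} = {p, q} := (Finset.insert_eq p {q}).symm
  have e4 : ({q} : Finset V) ∪ {p} = {p, q} := by
    rw [Finset.union_comm]; exact (Finset.insert_eq p {q}).symm
  have e5 : ({p} : Finset V) ∩ {p, q} = {p} := Finset.inter_eq_left.2 (by simp)
  have e6 : ({p, q} : Finset V) ∩ {p} = {p} := Finset.inter_eq_right.2 (by simp)
  have e7 : ({p} : Finset V) ∪ {p, q} = {p, q} := Finset.union_eq_right.2 (by simp)
  have e8 : ({p, q} : Finset V) ∪ {p} = {p, q} := Finset.union_eq_left.2 (by simp)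
  have e9 : ({q} : Finset V) ∩ {p, q} = {q} := Finset.inter_eq_left.2 (by simp)
  have e10 : ({p, q} : Finset V) ∩ {q} = {q} := Finset.inter_eq_right.2 (by simp)
  have e11 : ({q} : Finset V) ∪ {p, q} = {p, q} := Finset.union_eq_right.2 (by simp)
  have e12 : ({p, q} : Finset V) ∪ {q} = {p, q} := Finset.union_eq_left.2 (by simp)
  have hα := hp.nonneg c₁
  have hα' := sub_nonneg.2 (hp.le_one c₁)
  have hβ := hp.nonneg c₂
  have hβ' := sub_nonneg.2 (hp.le_one c₂)
  have hγ := hp.nonneg c₃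
  have hγ2 : 0 ≤ 2 - pr c₃ := by linarith [hp.le_one c₃]
  have key1 : 0 ≤ pr c₁ * (1 - pr c₁) * pr c₂ * (1 - pr c₂) * pr c₃ * (2 - pr c₃) :=
    mul_nonneg (mul_nonneg (mul_nonneg (mul_nonneg (mul_nonneg hα hα') hβ) hβ') hγ) hγ2
  have key2 : 0 ≤ (1 - pr c₁) * (1 - pr c₂) * pr c₃ * (pr c₁ * (1 - pr c₂)) :=
    mul_nonneg (mul_nonneg (mul_nonneg hα' hβ') hγ) (mul_nonneg hα hβ')
  have key3 : 0 ≤ (1 - pr c₁) * (1 - pr c₂) * pr c₃ * ((1 - pr c₁) * pr c₂) :=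
    mul_nonneg (mul_nonneg (mul_nonneg hα' hβ') hγ) (mul_nonneg hα' hβ)
  rcases subset_pair_cases hpq hW with rfl | rfl | rfl | rfl <;>
    rcases subset_pair_cases hpq hW' with rfl | rfl | rfl | rfl <;>
    simp only [Finset.inter_self, Finset.union_self, Finset.empty_inter, Finset.inter_empty,
      Finset.empty_union, Finset.union_empty, e1, e2, e3, e4, e5, e6, e7, e8, e9, e10, e11, e12,
      h.nu_empty pr h12 h13 h1ρ h23 h2ρ h3ρ, h.nu_p pr h12 h13 h1ρ h23 h2ρ h3ρ,
      h.nu_q pr h12 h13 h1ρ h23 h2ρ h3ρ, h.nu_pq pr h12 h13 h1ρ h23 h2ρ h3ρ] <;>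
    nlinarith [key1, key2, key3]

end TriLevels

section TriMain

variable {V : Type*} {E : Type*} [Fintype V] [DecidableEq V] [Fintype E] [DecidableEq E]
  {R : Type*} [Field R] [LinearOrder R] [IsStrictOrderedRing R]
  {arcs : E → Finset (V × V)} {s p q a w : V} {c₁ c₂ c₃ cρ cτ : E}

/-- **THEOREM (row 2′DARC over the undirected triangle with a tail, every head).**  `TriCore`
with five distinct coins, `SameEnds`, `t, w ∉ {s, p, q, a}` ⟹ `Φ_D({s ↛ t in D + (a → w)}) ≥ 0`
for the markers `p, q`; no non-degeneracy hypothesis. -/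
theorem darc_of_triCore (pr : E → R) (hp : IsProbVec pr) (hS : SameEnds arcs)
    (h : TriCore arcs s p q a c₁ c₂ c₃ cρ cτ)
    (h12 : c₁ ≠ c₂) (h13 : c₁ ≠ c₃) (h1ρ : c₁ ≠ cρ) (h23 : c₂ ≠ c₃) (h2ρ : c₂ ≠ cρ) (h3ρ : c₃ ≠ cρ)
    {t : V} (htC : t ∉ ({p, q, a} : Finset V)) (hts : t ≠ s) (hws : w ≠ s)
    (hwC : w ∉ ({p, q, a} : Finset V)) :
    DARC pr arcs s {t} p q a w := by
  have htC' : t ∉ insert a ({p, q} : Finset V) := by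
    intro ht; apply htC
    simp only [Finset.mem_insert, Finset.mem_singleton] at ht ⊢; tauto
  have hwC' : w ∉ insert a ({p, q} : Finset V) := by
    intro hw; apply hwC
    simp only [Finset.mem_insert, Finset.mem_singleton] at hw ⊢; tauto
  exact darc_of_orTailLsm pr hp hS h.orTailU (h.level_lsm pr hp h12 h13 h1ρ h23 h2ρ h3ρ) htC' hts
    hws hwC'

end TriMain

end Summit.Ventures.PercRepro2.Coin
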